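import Mathlib.Topology.Algebra.InfiniteSum.ENNReal
import Mathlib.Topology.Instances.ENNReal.Lemmas
import Mathlib.Analysis.SpecialFunctions.Pow.Real
import Mathlib.Logic.Equiv.Fin.Basic
import Mathlib.Data.Nat.Choose.Sum
import HarnessLib

/-!
# The binomial moment bound `E[(1 + Bin(m, P))^{-1/2}] ≤ ((m + 1) p)^{-1/2}`

Support file for item `stmt-CriticalPhenomena-7117`
(`SAWTotalPositivity.CriticalBubbleBound`, line `kesten-product-renewal-dictionary`): the moment
bound behind the anti-concentration estimate for the transversal coordinate of Kesten's renewal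
walk (Madras–Slade, Lemma 8.1.3). For a sub-probability weight `μ : I → ℝ≥0∞` (`Σ μ ≤ 1`), an
integer charge `q : I → ℤ` whose non-zero set carries mass `P ≥ p > 0`, and `K(s) := #{k : q (s k) ≠ 0}`
for `s : Fin m → I`,

  `Σ' s, (Π_k μ (s k)) · (K(s) + 1)^{-1/2} ≤ (p (m + 1))^{-1/2}`.

Proof: the product (Fubini) identity `Σ'_{s : Fin m → I} Π_k F k (s k) = Π_k Σ'_i F k i` in `ℝ≥0∞`
(`msbm_tsum_pi_prod`); grouping the tuples `s` by their support set `A = {k : q (s k) ≠ 0}` and the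
sets `A` by cardinality turns the left side into the binomial sum
`Σ_j C(m, j) P^j Z^{m-j} (j + 1)^{-1/2}` with `Z` the mass of `{q = 0}`, `P + Z ≤ 1`
(`msbm_moment_eq`); finally AM–GM `(j + 1)^{-1/2} ≤ λ/2 + 1/(2 λ (j + 1))` with
`λ = (p (m + 1))^{-1/2}` and the identity `Σ_j C(m, j) P^j Z^{m-j} / (j + 1) ≤ 1 / ((m + 1) P)`
(`msbm_binom_recip_sum_le`, from `(m + 1) C(m, j) = (j + 1) C(m + 1, j + 1)` and the binomial
theorem) give the bound (`msbm_real_bound`).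

References: N. Madras, G. Slade, *The Self-Avoiding Walk* (1993), §8.1, Lemma 8.1.3 and its proof.
-/

noncomputable section

open scoped ENNReal NNReal BigOperators
open Classical

namespace Summit.CriticalPhenomena.SAWScalingLimit.Theorems.CriticalBubbleBound.Kesten.MS

/-! ### Scalar inequalities in `ℝ` -/

/-- AM–GM in the form `1/√x ≤ λ/2 + 1/(2 λ x)` for `λ, x > 0`
(the difference is `(λ √x - 1)² / (2 λ x)`). [folklore] -/
theorem msbm_inv_sqrt_le {L x : ℝ} (hL : 0 < L) (hx : 0 < x) :
    1 / Real.sqrt x ≤ L / 2 + 1 / (2 * L * x) := by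
  obtain ⟨s, hs, rfl⟩ : ∃ s : ℝ, 0 < s ∧ x = s ^ 2 :=
    ⟨Real.sqrt x, Real.sqrt_pos.2 hx, (Real.sq_sqrt hx.le).symm⟩
  rw [Real.sqrt_sq hs.le]
  have key : L / 2 + 1 / (2 * L * s ^ 2) - 1 / s = (L * s - 1) ^ 2 / (2 * L * s ^ 2) := by
    field_simp
    ring
  have : 0 ≤ (L * s - 1) ^ 2 / (2 * L * s ^ 2) := by positivity
  linarith

/-- `Σ_{j ≤ m} C(m, j) P^j Z^{m-j} / (j + 1) ≤ 1 / ((m + 1) P)` for `0 < P`, `0 ≤ Z`, `P + Z ≤ 1`: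
multiplying by `(m + 1) P` and using `(m + 1) C(m, j) = (j + 1) C(m + 1, j + 1)` the left side
becomes the binomial expansion of `(P + Z)^{m+1}` without its `j = 0` term. [folklore] -/
theorem msbm_binom_recip_sum_le (m : ℕ) {P Z : ℝ} (hP : 0 < P) (hZ : 0 ≤ Z) (hPZ : P + Z ≤ 1) :
    ∑ j ∈ Finset.range (m + 1), P ^ j * Z ^ (m - j) * (m.choose j : ℝ) / (j + 1)
      ≤ 1 / ((m + 1) * P) := by
  rw [le_div_iff₀ (by positivity)]
  calc (∑ j ∈ Finset.range (m + 1), P ^ j * Z ^ (m - j) * (m.choose j : ℝ) / (j + 1))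
        * ((m + 1) * P)
      = ∑ j ∈ Finset.range (m + 1), P ^ (j + 1) * Z ^ (m - j) * ((m + 1).choose (j + 1) : ℝ) := by
        rw [Finset.sum_mul]
        refine Finset.sum_congr rfl fun j _ => ?_
        have h : (((m + 1).choose (j + 1) : ℕ) : ℝ)
            = ((m : ℝ) + 1) * (m.choose j : ℝ) / ((j : ℝ) + 1) := by
          rw [eq_div_iff (by positivity)]
          exact_mod_cast (Nat.add_one_mul_choose_eq m j).symm
        rw [h]
        field_simp
        ring
    _ ≤ ∑ j ∈ Finset.range (m + 1 + 1), P ^ j * Z ^ (m + 1 - j) * ((m + 1).choose j : ℝ) := by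
        rw [Finset.sum_range_succ' _ (m + 1)]
        simp only [Nat.add_sub_add_right, pow_zero, Nat.sub_zero, Nat.choose_zero_right,
          Nat.cast_one, one_mul, mul_one]
        have : 0 ≤ Z ^ (m + 1) := by positivity
        linarith
    _ = (P + Z) ^ (m + 1) := (add_pow P Z (m + 1)).symm
    _ ≤ 1 := pow_le_one₀ (by linarith) hPZ

/-- The binomial moment bound in `ℝ`: for `0 < p ≤ P`, `0 ≤ Z`, `P + Z ≤ 1`,
`Σ_{j ≤ m} C(m, j) P^j Z^{m-j} (j + 1)^{-1/2} ≤ (p (m + 1))^{-1/2}` (AM–GM with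
`λ = (p (m + 1))^{-1/2}`, the binomial theorem and `msbm_binom_recip_sum_le`). [folklore] -/
theorem msbm_real_bound (m : ℕ) {p P Z : ℝ} (hp : 0 < p) (hpP : p ≤ P) (hZ : 0 ≤ Z)
    (hPZ : P + Z ≤ 1) :
    ∑ j ∈ Finset.range (m + 1), P ^ j * Z ^ (m - j) * (m.choose j : ℝ) * (1 / Real.sqrt (j + 1))
      ≤ 1 / Real.sqrt (p * (m + 1)) := by
  have hP : 0 < P := hp.trans_le hpP
  set L := 1 / Real.sqrt (p * (m + 1)) with hL
  have hL0 : 0 < L := by positivity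
  have hL2 : L ^ 2 = 1 / (p * (m + 1)) := by
    rw [hL, div_pow, Real.sq_sqrt (by positivity), one_pow]
  calc ∑ j ∈ Finset.range (m + 1), P ^ j * Z ^ (m - j) * (m.choose j : ℝ) * (1 / Real.sqrt (j + 1))
      ≤ ∑ j ∈ Finset.range (m + 1),
          P ^ j * Z ^ (m - j) * (m.choose j : ℝ) * (L / 2 + 1 / (2 * L * (j + 1))) := by
        gcongr with j _
        exact msbm_inv_sqrt_le hL0 (by positivity)
    _ = (L / 2) * ∑ j ∈ Finset.range (m + 1), P ^ j * Z ^ (m - j) * (m.choose j : ℝ)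
        + (1 / (2 * L))
          * ∑ j ∈ Finset.range (m + 1), P ^ j * Z ^ (m - j) * (m.choose j : ℝ) / (j + 1) := by
        rw [Finset.mul_sum, Finset.mul_sum, ← Finset.sum_add_distrib]
        refine Finset.sum_congr rfl fun j _ => ?_
        field_simp
    _ ≤ (L / 2) * 1 + (1 / (2 * L)) * (1 / ((m + 1) * p)) := by
        gcongr
        · rw [← add_pow]; exact pow_le_one₀ (by linarith) hPZ
        · calc _ ≤ 1 / ((m + 1) * P) := msbm_binom_recip_sum_le m hP hZ hPZ
            _ ≤ 1 / ((m + 1) * p) := by gcongr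
    _ = L := by
        rw [show (1 : ℝ) / ((m + 1) * p) = L ^ 2 by rw [hL2]; ring]
        field_simp
        ring

/-! ### The product weight on `Fin m → I` in `ℝ≥0∞` -/

/-- Fubini for product weights: `Σ'_{s : Fin m → I} Π_k F k (s k) = Π_k Σ'_i F k i` in `ℝ≥0∞`
(induction on `m`, splitting off the first coordinate with `Fin.consEquiv`). [folklore] -/
theorem msbm_tsum_pi_prod {I : Type} : ∀ (m : ℕ) (F : Fin m → I → ℝ≥0∞),
    ∑' s : Fin m → I, ∏ k, F k (s k) = ∏ k, ∑' i, F k i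
  | 0, F => by simp
  | m + 1, F => by
      rw [← (Fin.consEquiv (fun _ => I)).tsum_eq, ENNReal.tsum_prod', Fin.prod_univ_succ,
        ← ENNReal.tsum_mul_right]
      refine tsum_congr fun a => ?_
      rw [← msbm_tsum_pi_prod m (fun k => F k.succ), ← ENNReal.tsum_mul_left]
      refine tsum_congr fun t => ?_
      simp [Fin.prod_univ_succ]

/-- Grouping by support: the `μ^{⊗ m}`-mass of the tuples `s : Fin m → I` whose non-zero-charge set
`{k : q (s k) ≠ 0}` is exactly `A` equals `P^{#A} Z^{m - #A}`, `P = μ {q ≠ 0}`, `Z = μ {q = 0}`.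
[folklore] -/
theorem msbm_tsum_support_eq {I : Type} (μ : I → ℝ≥0∞) (q : I → ℤ) (m : ℕ) (A : Finset (Fin m)) :
    ∑' s : Fin m → I, (if (Finset.univ.filter fun k => q (s k) ≠ 0) = A then ∏ k, μ (s k) else 0)
      = (∑' i, if q i ≠ 0 then μ i else 0) ^ A.card
        * (∑' i, if q i = 0 then μ i else 0) ^ (m - A.card) := by
  set F : Fin m → I → ℝ≥0∞ := fun k i => if k ∈ A then (if q i ≠ 0 then μ i else 0)
    else (if q i = 0 then μ i else 0) with hF
  have step1 : ∀ s : Fin m → I,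
      (if (Finset.univ.filter fun k => q (s k) ≠ 0) = A then ∏ k, μ (s k) else (0 : ℝ≥0∞))
        = ∏ k, F k (s k) := by
    intro s
    split_ifs with hA
    · refine Finset.prod_congr rfl fun k _ => ?_
      have hk : k ∈ A ↔ q (s k) ≠ 0 := by rw [← hA]; simp
      by_cases hq : q (s k) = 0 <;> simp [hF, hq, hk]
    · obtain ⟨k, hk⟩ : ∃ k, ¬ (q (s k) ≠ 0 ↔ k ∈ A) :=
        not_forall.mp fun h => hA (Finset.ext fun k => by simpa using h k)
      symm
      apply Finset.prod_eq_zero (Finset.mem_univ k)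
      by_cases hq : q (s k) = 0 <;> simp_all
  have step3 : ∀ k : Fin m, ∑' i, F k i
      = if k ∈ A then (∑' i, if q i ≠ 0 then μ i else 0)
        else (∑' i, if q i = 0 then μ i else 0) := by
    intro k
    by_cases hk : k ∈ A <;> simp [hF, hk]
  rw [tsum_congr step1, msbm_tsum_pi_prod m F, Fintype.prod_congr _ _ step3, Finset.prod_ite,
    Finset.prod_const, Finset.prod_const, Finset.filter_univ_mem, Finset.filter_not,
    Finset.filter_univ_mem, Finset.card_univ_sdiff, Fintype.card_fin]

/-- The moment identity: for any `g : ℕ → ℝ≥0∞`,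
`Σ'_s (Π_k μ (s k)) g (K(s)) = Σ_{j ≤ m} P^j Z^{m-j} C(m, j) g j`, `K(s) = #{k : q (s k) ≠ 0}`
(split the sum over the `2^m` supports, `msbm_tsum_support_eq`, regroup by cardinality). [folklore] -/
theorem msbm_moment_eq {I : Type} (μ : I → ℝ≥0∞) (q : I → ℤ) (m : ℕ) (g : ℕ → ℝ≥0∞) :
    ∑' s : Fin m → I, (∏ k, μ (s k)) * g (Finset.univ.filter fun k => q (s k) ≠ 0).card
      = ∑ j ∈ Finset.range (m + 1), (∑' i, if q i ≠ 0 then μ i else 0) ^ j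
          * (∑' i, if q i = 0 then μ i else 0) ^ (m - j) * (m.choose j : ℝ≥0∞) * g j := by
  have h1 : ∀ s : Fin m → I, (∏ k, μ (s k)) * g (Finset.univ.filter fun k => q (s k) ≠ 0).card
      = ∑ A : Finset (Fin m), (if (Finset.univ.filter fun k => q (s k) ≠ 0) = A
          then (∏ k, μ (s k)) * g A.card else 0) := by
    intro s
    rw [Finset.sum_ite_eq, if_pos (Finset.mem_univ _)]
  simp_rw [h1]
  rw [Summable.tsum_finsetSum (fun A _ => ENNReal.summable)]
  have h2 : ∀ A : Finset (Fin m),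
      (∑' s : Fin m → I, (if (Finset.univ.filter fun k => q (s k) ≠ 0) = A
        then (∏ k, μ (s k)) * g A.card else 0))
        = (∑' i, if q i ≠ 0 then μ i else 0) ^ A.card
          * (∑' i, if q i = 0 then μ i else 0) ^ (m - A.card) * g A.card := by
    intro A
    rw [← msbm_tsum_support_eq μ q m A, ← ENNReal.tsum_mul_right]
    refine tsum_congr fun s => ?_
    split_ifs <;> simp
  simp_rw [h2]
  have h3 := Finset.sum_powerset_apply_card
    (fun j => (∑' i, if q i ≠ 0 then μ i else 0) ^ j
      * (∑' i, if q i = 0 then μ i else 0) ^ (m - j) * g j)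
    (x := (Finset.univ : Finset (Fin m)))
  rw [Finset.powerset_univ, Finset.card_univ, Fintype.card_fin] at h3
  rw [h3]
  refine Finset.sum_congr rfl fun j _ => ?_
  rw [nsmul_eq_mul]
  ring

/-! ### The stub -/

/-- **Madras–Slade, Lemma 8.1.3 (the binomial moment bound).** For a sub-probability weight
`μ : I → ℝ≥0∞` (`Σ' μ ≤ 1`), an integer charge `q` whose non-zero set carries mass
`≥ ENNReal.ofReal p`, `p > 0`, and every `m`,
`Σ'_{s : Fin m → I} (Π_k μ (s k)) · (K(s) + 1)^{-1/2} ≤ (p (m + 1))^{-1/2}`,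
`K(s) = #{k : q (s k) ≠ 0}` — i.e. `E[(1 + Bin(m, P))^{-1/2}] ≤ ((m + 1) P)^{-1/2}` for the
sub-probability product weight. [cite: MadrasSlade1993, Lemma 8.1.3] -/
theorem ms_binomialMoment : ∀ {I : Type} (μ : I → ℝ≥0∞) (q : I → ℤ) (p : ℝ), 0 < p → (∑' i, μ i) ≤ 1 → ENNReal.ofReal p ≤ (∑' i, if q i ≠ 0 then μ i else 0) → ∀ m : ℕ, (∑' s : Fin m → I, (∏ k, μ (s k)) * ENNReal.ofReal (1 / Real.sqrt (((Finset.univ : Finset (Fin m)).filter (fun k => q (s k) ≠ 0)).card + 1))) ≤ ENNReal.ofReal (1 / Real.sqrt (p * (m + 1))) := by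
  intro I μ q p hp hμ hpP m
  set P : ℝ≥0∞ := ∑' i, if q i ≠ 0 then μ i else 0 with hPdef
  set Z : ℝ≥0∞ := ∑' i, if q i = 0 then μ i else 0 with hZdef
  have hPZ : P + Z = ∑' i, μ i := by
    rw [hPdef, hZdef, ← ENNReal.tsum_add]
    refine tsum_congr fun i => ?_
    by_cases hq : q i = 0 <;> simp [hq]
  have hPZ1 : P + Z ≤ 1 := hPZ ▸ hμ
  have hPtop : P ≠ ⊤ := ne_top_of_le_ne_top ENNReal.one_ne_top (le_trans le_self_add hPZ1)
  have hZtop : Z ≠ ⊤ := ne_top_of_le_ne_top ENNReal.one_ne_top (le_trans le_add_self hPZ1)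
  have hpP' : p ≤ P.toReal := (ENNReal.ofReal_le_iff_le_toReal hPtop).1 hpP
  have hZ' : 0 ≤ Z.toReal := ENNReal.toReal_nonneg
  have hPZ' : P.toReal + Z.toReal ≤ 1 := by
    rw [← ENNReal.toReal_add hPtop hZtop, ← ENNReal.toReal_one]
    exact ENNReal.toReal_mono ENNReal.one_ne_top hPZ1
  calc (∑' s : Fin m → I, (∏ k, μ (s k)) * ENNReal.ofReal (1 / Real.sqrt
          (((Finset.univ : Finset (Fin m)).filter (fun k => q (s k) ≠ 0)).card + 1)))
      = ∑ j ∈ Finset.range (m + 1), P ^ j * Z ^ (m - j) * (m.choose j : ℝ≥0∞)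
          * ENNReal.ofReal (1 / Real.sqrt (j + 1)) :=
        msbm_moment_eq μ q m (fun j => ENNReal.ofReal (1 / Real.sqrt (j + 1)))
    _ ≤ ENNReal.ofReal (1 / Real.sqrt (p * (m + 1))) := by
        have hterm : ∀ j ∈ Finset.range (m + 1), P ^ j * Z ^ (m - j) * (m.choose j : ℝ≥0∞)
            * ENNReal.ofReal (1 / Real.sqrt (j + 1)) ≠ ⊤ := fun j _ => by finiteness
        rw [ENNReal.le_ofReal_iff_toReal_le (ENNReal.sum_ne_top.2 hterm) (by positivity),
          ENNReal.toReal_sum hterm]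
        calc ∑ j ∈ Finset.range (m + 1), (P ^ j * Z ^ (m - j) * (m.choose j : ℝ≥0∞)
              * ENNReal.ofReal (1 / Real.sqrt (j + 1))).toReal
            = ∑ j ∈ Finset.range (m + 1), P.toReal ^ j * Z.toReal ^ (m - j) * (m.choose j : ℝ)
              * (1 / Real.sqrt (j + 1)) := by
              refine Finset.sum_congr rfl fun j _ => ?_
              rw [ENNReal.toReal_mul, ENNReal.toReal_mul, ENNReal.toReal_mul, ENNReal.toReal_pow,
                ENNReal.toReal_pow, ENNReal.toReal_natCast, ENNReal.toReal_ofReal (by positivity)]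
          _ ≤ 1 / Real.sqrt (p * (m + 1)) := msbm_real_bound m hp hpP' hZ' hPZ'

end Summit.CriticalPhenomena.SAWScalingLimit.Theorems.CriticalBubbleBound.Kesten.MS

end
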